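import Literature.Analysis.OperatorTheory.HermitianKernelSpectralTrace
import Literature.Analysis.OperatorTheory.JointEigenbasis
import Literature.Analysis.OperatorTheory.CompactPositiveTopLevel
import Literature.Analysis.OperatorTheory.PathKernelDomination
import HarnessLib

/-!
# Crux `IRcof` (stmt-QuantumFields-26930) · line `equipartition_seam` (row 47) · stub D `KernelCurrency.SpectralDictV` — SPECTRAL DICTIONARY,
# PART 1∕5 — §1 Koopman operators, §2 the unitary representation of a finite group of measure-preserving twists and its commutation with an invariant kernel operator, §3 the JOINT eigenbasis of the kernel operator and the twists

SOURCE OF RECORD: `Cruxes/IRcof/Lines/equipartition_seam_SpectralDict.lean` (crux write 2e444f4e44a5, 1436 l.; author ideator ym-ir-idea-22 g7; critic ym-ir-crit-3 g5 TYPEREAD CLEAN + JUNK ∕ COSTUME ∕ SHRED PASS, bus l.≈1712, landing conditions L1–L4) — split VERBATIM along its §§ into ≤ 400-line Theorems files by LEAD prover ym-ir-line-ab-p1 g8 (LAND-ASK of idea-22 g7). §0 of the source (a verbatim copy of `Literature/Analysis/OperatorTheory/HermitianKernelSandwichedTrace.lean`) is NOT landed (condition L2): the part that needs it imports the Literature module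 by name.

HONEST FRAMING.  Abstract operator theory on `L²(X, μ; ℂ)` (Koopman unitaries, joint eigenbasis, trace formulas, kernel calculus); nothing located on the lattice is proved by this file (stubs S1, S3ʷ, T, N, S5ᵛ of row 47 open; D is re-located onto the lattice stub L `SliceRealisationV` in the last part); row 47 class PWP, mechanism 0, width 0; `IRcof` ∕ `IR` 0∕1; the Yang–Mills mass gap (Clay) is NOT proved by anything in this tree; R4 closes only the conditional finite-𝕋⁴ rung `BalabanLadder.UV`.
-/

noncomputable section

open MeasureTheory Filter Function Topology
open scoped InnerProductSpace ComplexConjugate ENNReal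
open Literature.Analysis.OperatorTheory

namespace Summit.QuantumFields.YangMills.Cruxes.IRcof.EquipartitionSeam.SpectralDict

variable {X : Type*} [MeasurableSpace X] {μ : Measure X}

/-! ## §1 Koopman operators of measure-preserving maps on `L²(X, μ; ℂ)` -/

/-- The Koopman operator `U_T φ = φ ∘ T` of a measure-preserving map `T`, a linear isometry of `L²(μ; ℂ)`. -/
def koop (T : X → X) (hT : MeasurePreserving T μ μ) : Lp ℂ 2 μ →L[ℂ] Lp ℂ 2 μ :=
  (Lp.compMeasurePreservingₗᵢ ℂ T hT).toContinuousLinearMap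

/-- Auxiliary `koop_apply` of the spectral-dictionary port (its statement is its type; rôle explained in the module ∕ section docstrings). -/
theorem koop_apply {T : X → X} (hT : MeasurePreserving T μ μ) (φ : Lp ℂ 2 μ) :
    koop T hT φ = Lp.compMeasurePreserving T hT φ := rfl

/-- Auxiliary `coeFn_koop` of the spectral-dictionary port (its statement is its type; rôle explained in the module ∕ section docstrings). -/
theorem coeFn_koop {T : X → X} (hT : MeasurePreserving T μ μ) (φ : Lp ℂ 2 μ) :
    (koop T hT φ : X → ℂ) =ᵐ[μ] fun x => φ (T x) :=
  Lp.coeFn_compMeasurePreserving φ hT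

/-- Auxiliary `norm_koop_apply` of the spectral-dictionary port (its statement is its type; rôle explained in the module ∕ section docstrings). -/
theorem norm_koop_apply {T : X → X} (hT : MeasurePreserving T μ μ) (φ : Lp ℂ 2 μ) :
    ‖koop T hT φ‖ = ‖φ‖ :=
  Lp.norm_compMeasurePreserving φ hT

/-- Auxiliary `norm_koop_le` of the spectral-dictionary port (its statement is its type; rôle explained in the module ∕ section docstrings). -/
theorem norm_koop_le {T : X → X} (hT : MeasurePreserving T μ μ) : ‖koop T hT‖ ≤ 1 :=
  ContinuousLinearMap.opNorm_le_bound _ zero_le_one fun φ => by rw [norm_koop_apply, one_mul]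

/-- Integrals are invariant under a measure-preserving map. -/
theorem integral_comp_mp {T : X → X} (hT : MeasurePreserving T μ μ) {g : X → ℂ}
    (hg : AEStronglyMeasurable g μ) : ∫ x, g (T x) ∂μ = ∫ x, g x ∂μ := by
  have h := integral_map (μ := μ) hT.measurable.aemeasurable (f := g) (by rw [hT.map_eq]; exact hg)
  rw [hT.map_eq] at h
  exact h.symm

/-- Pull-back of an a.e. equality along a measure-preserving map. -/
theorem ae_eq_comp_mp {T : X → X} (hT : MeasurePreserving T μ μ) {f g : X → ℂ} (h : f =ᵐ[μ] g) :
    (fun x => f (T x)) =ᵐ[μ] fun x => g (T x) :=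
  hT.quasiMeasurePreserving.ae_eq_comp h

/-! ## §2 A finite group of measure-preserving twists: the unitary representation `U` and its commutation with
the kernel operator -/

section Group

variable {Γ : Type*} [Group Γ] {T : Γ → X → X}

omit [MeasurableSpace X] in
/-- Auxiliary `apply_inv_apply_of_hom` of the spectral-dictionary port (its statement is its type; rôle explained in the module ∕ section docstrings). -/
theorem apply_inv_apply_of_hom (hT1 : T 1 = id) (hTmul : ∀ a b, T (a * b) = T a ∘ T b) (a : Γ) (x : X) :
    T a (T a⁻¹ x) = x := by
  have h := congrFun (hTmul a a⁻¹) x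
  rw [mul_inv_cancel, hT1] at h
  exact h.symm

omit [MeasurableSpace X] in
/-- Auxiliary `inv_apply_apply_of_hom` of the spectral-dictionary port (its statement is its type; rôle explained in the module ∕ section docstrings). -/
theorem inv_apply_apply_of_hom (hT1 : T 1 = id) (hTmul : ∀ a b, T (a * b) = T a ∘ T b) (a : Γ) (x : X) :
    T a⁻¹ (T a x) = x := by
  have h := congrFun (hTmul a⁻¹ a) x
  rw [inv_mul_cancel, hT1] at h
  exact h.symm

variable (hTm : ∀ c, MeasurePreserving (T c) μ μ)

/-- `U_c U_d = U_{dc}` (`φ ∘ T_d ∘ T_c = φ ∘ T_{dc}`). -/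
theorem koop_mul_koop (hTmul : ∀ a b, T (a * b) = T a ∘ T b) (c d : Γ) :
    koop (T c) (hTm c) * koop (T d) (hTm d) = koop (T (d * c)) (hTm (d * c)) := by
  refine ContinuousLinearMap.ext fun φ => Lp.ext ?_
  rw [mul_apply_eq_comp]
  refine (coeFn_koop (hTm c) _).trans ?_
  refine (ae_eq_comp_mp (hTm c) (coeFn_koop (hTm d) φ)).trans ?_
  refine ((coeFn_koop (hTm (d * c)) φ).trans ?_).symm
  exact Eventually.of_forall fun x => by simp only [hTmul d c, Function.comp_apply]

/-- Auxiliary `koop_one` of the spectral-dictionary port (its statement is its type; rôle explained in the module ∕ section docstrings). -/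
theorem koop_one (hT1 : T 1 = id) : koop (T 1) (hTm 1) = (1 : Lp ℂ 2 μ →L[ℂ] Lp ℂ 2 μ) := by
  refine ContinuousLinearMap.ext fun φ => Lp.ext ?_
  refine (coeFn_koop (hTm 1) φ).trans (Eventually.of_forall fun x => ?_)
  simp [hT1]

/-- Auxiliary `koop_comm` of the spectral-dictionary port (its statement is its type; rôle explained in the module ∕ section docstrings). -/
theorem koop_comm (hTmul : ∀ a b, T (a * b) = T a ∘ T b) (hcomm : ∀ a b : Γ, a * b = b * a) (c d : Γ) :
    koop (T c) (hTm c) * koop (T d) (hTm d) = koop (T d) (hTm d) * koop (T c) (hTm c) := by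
  rw [koop_mul_koop hTm hTmul, koop_mul_koop hTm hTmul]
  have h : d * c = c * d := hcomm d c
  simp only [h]

/-- `U_{c⁻¹} = U_c^*` (change of variables `x ↦ T_c x` in `⟪U_{c⁻¹} φ, ψ⟫`). -/
theorem adjoint_koop (hT1 : T 1 = id) (hTmul : ∀ a b, T (a * b) = T a ∘ T b) (c : Γ) :
    ContinuousLinearMap.adjoint (koop (T c) (hTm c)) = koop (T c⁻¹) (hTm c⁻¹) := by
  symm
  rw [ContinuousLinearMap.eq_adjoint_iff]
  intro φ ψ
  rw [L2.inner_def, L2.inner_def]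
  have h1 : ∫ x, ⟪(koop (T c⁻¹) (hTm c⁻¹) φ : X → ℂ) x, (ψ : X → ℂ) x⟫_ℂ ∂μ =
      ∫ x, conj ((φ : X → ℂ) (T c⁻¹ x)) * (ψ : X → ℂ) x ∂μ := by
    refine integral_congr_ae ?_
    filter_upwards [coeFn_koop (hTm c⁻¹) φ] with x hx
    rw [hx, RCLike.inner_apply']
  have h2 : ∫ x, ⟪(φ : X → ℂ) x, (koop (T c) (hTm c) ψ : X → ℂ) x⟫_ℂ ∂μ =
      ∫ x, conj ((φ : X → ℂ) x) * (ψ : X → ℂ) (T c x) ∂μ := by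
    refine integral_congr_ae ?_
    filter_upwards [coeFn_koop (hTm c) ψ] with x hx
    rw [hx, RCLike.inner_apply']
  rw [h1, h2]
  -- substitute `x = T_c u` in the first integral
  have hg : AEStronglyMeasurable (fun x => conj ((φ : X → ℂ) (T c⁻¹ x)) * (ψ : X → ℂ) x) μ :=
    (RCLike.continuous_conj.comp_aestronglyMeasurable
      ((Lp.aestronglyMeasurable φ).comp_measurePreserving (hTm c⁻¹))).mul (Lp.aestronglyMeasurable ψ)
  rw [← integral_comp_mp (hTm c) hg]
  refine integral_congr_ae (Eventually.of_forall fun u => ?_)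
  simp only [inv_apply_apply_of_hom hT1 hTmul]

/-- Auxiliary `star_koop` of the spectral-dictionary port (its statement is its type; rôle explained in the module ∕ section docstrings). -/
theorem star_koop (hT1 : T 1 = id) (hTmul : ∀ a b, T (a * b) = T a ∘ T b) (c : Γ) :
    star (koop (T c) (hTm c)) = koop (T c⁻¹) (hTm c⁻¹) := by
  rw [ContinuousLinearMap.star_eq_adjoint, adjoint_koop hTm hT1 hTmul]

omit [Group Γ] in
/-- `⟪bᵢ, U_c bᵢ⟫` has norm at most one. -/
theorem norm_inner_koop_le (c : Γ) (φ : Lp ℂ 2 μ) (hφ : ‖φ‖ = 1) :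
    ‖⟪φ, koop (T c) (hTm c) φ⟫_ℂ‖ ≤ 1 := by
  calc ‖⟪φ, koop (T c) (hTm c) φ⟫_ℂ‖ ≤ ‖φ‖ * ‖koop (T c) (hTm c) φ‖ := norm_inner_le_norm _ _
    _ = 1 := by rw [norm_koop_apply, hφ, mul_one]

variable {K : X → X → ℂ} {A : Lp ℂ 2 μ →L[ℂ] Lp ℂ 2 μ}

omit [Group Γ] in
/-- **The twists commute with the kernel operator**: `K(T_c x, T_c y) = K(x, y)` gives `A U_c = U_c A`. -/
theorem kernelOp_mul_koop (hK : StronglyMeasurable (uncurry K))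
    (hA : ∀ φ : Lp ℂ 2 μ, (A φ : X → ℂ) =ᵐ[μ] fun x => ∫ y, K x y * φ y ∂μ)
    (hKT : ∀ c x y, K (T c x) (T c y) = K x y) (c : Γ) :
    A * koop (T c) (hTm c) = koop (T c) (hTm c) * A := by
  refine ContinuousLinearMap.ext fun φ => Lp.ext ?_
  have h1 : ((A * koop (T c) (hTm c)) φ : X → ℂ) =ᵐ[μ]
      fun x => ∫ y, K x y * (koop (T c) (hTm c) φ : X → ℂ) y ∂μ := by
    rw [mul_apply_eq_comp]; exact hA _
  have h2 : ∀ x, ∫ y, K x y * (koop (T c) (hTm c) φ : X → ℂ) y ∂μ = ∫ y, K x y * (φ : X → ℂ) (T c y) ∂μ :=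
    fun x => integral_congr_ae (by filter_upwards [coeFn_koop (hTm c) φ] with y hy; rw [hy])
  have h3 : ∀ x, ∫ y, K x y * (φ : X → ℂ) (T c y) ∂μ = ∫ y, K (T c x) y * (φ : X → ℂ) y ∂μ := by
    intro x
    have hg : AEStronglyMeasurable (fun y => K (T c x) y * (φ : X → ℂ) y) μ :=
      (hK.of_uncurry_left (x := T c x)).aestronglyMeasurable.mul (Lp.aestronglyMeasurable φ)
    rw [← integral_comp_mp (hTm c) hg]
    refine integral_congr_ae (Eventually.of_forall fun y => ?_)
    simp only [hKT]
  have h4 : ((koop (T c) (hTm c) * A) φ : X → ℂ) =ᵐ[μ] fun x => (A φ : X → ℂ) (T c x) := by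
    rw [mul_apply_eq_comp]; exact coeFn_koop _ _
  have h5 : (fun x => (A φ : X → ℂ) (T c x)) =ᵐ[μ] fun x => ∫ y, K (T c x) y * (φ : X → ℂ) y ∂μ :=
    ae_eq_comp_mp (hTm c) (hA φ)
  have h23 : (fun x => ∫ y, K x y * (koop (T c) (hTm c) φ : X → ℂ) y ∂μ) =
      fun x => ∫ y, K (T c x) y * (φ : X → ℂ) y ∂μ := funext fun x => by rw [h2 x, h3 x]
  rw [h23] at h1
  exact h1.trans (h4.trans h5).symm

end Group


/-! ## §3 The joint eigenbasis of the kernel operator and the twists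

For a compact self-adjoint positive `A` commuting with the unitary representation `U` of a COMMUTATIVE group of twists,
the family `A`, `A(U_c + U_c^*)`, `i·A(U_c − U_c^*)` is a commuting family of compact self-adjoint operators; a complete
orthonormal system of joint eigenvectors (tree: `JointSpectral.exists_orthonormal_dense_jointEigenvectors`) is an
eigenbasis of `A` on which every `U_c` acts by a unit multiplicative character WHEREVER `λᵢ ≠ 0` (on `ker A` nothing is
claimed and the character is set to `1`; all trace formulas below carry a factor `λᵢ^{≥2}`). -/

section Joint

variable {Γ : Type*} [Group Γ] {T : Γ → X → X} (hTm : ∀ c, MeasurePreserving (T c) μ μ)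

/-- The commuting compact self-adjoint family attached to `A` and the twists. -/
def jointFamily (A : Lp ℂ 2 μ →L[ℂ] Lp ℂ 2 μ) : Option (Γ × Bool) → (Lp ℂ 2 μ →L[ℂ] Lp ℂ 2 μ)
  | none => A
  | some (c, true) => A * (koop (T c) (hTm c) + koop (T c⁻¹) (hTm c⁻¹))
  | some (c, false) => Complex.I • (A * (koop (T c) (hTm c) - koop (T c⁻¹) (hTm c⁻¹)))

variable (hT1 : T 1 = id) (hTmul : ∀ a b, T (a * b) = T a ∘ T b) (hcomm : ∀ a b : Γ, a * b = b * a)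
  {A : Lp ℂ 2 μ →L[ℂ] Lp ℂ 2 μ} (hAsa : IsSelfAdjoint A) (hAc : IsCompactOperator A)
  (hAU : ∀ c, A * koop (T c) (hTm c) = koop (T c) (hTm c) * A)

include hT1 hTmul hAsa hAU in
/-- Auxiliary `isSelfAdjoint_jointFamily` of the spectral-dictionary port (its statement is its type; rôle explained in the module ∕ section docstrings). -/
theorem isSelfAdjoint_jointFamily (j : Option (Γ × Bool)) : IsSelfAdjoint (jointFamily hTm A j) := by
  have hU : ∀ c, star (koop (T c) (hTm c)) = koop (T c⁻¹) (hTm c⁻¹) := star_koop hTm hT1 hTmul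
  rcases j with _ | ⟨c, _ | _⟩
  · exact hAsa
  · -- `i A (U - U^*)`
    show IsSelfAdjoint (Complex.I • (A * (koop (T c) (hTm c) - koop (T c⁻¹) (hTm c⁻¹))))
    rw [IsSelfAdjoint, star_smul, star_mul, star_sub, hU, hU, inv_inv, hAsa.star_eq, Complex.star_def,
      Complex.conj_I, mul_sub, sub_mul, hAU, hAU, neg_smul, ← smul_neg, neg_sub]
  · show IsSelfAdjoint (A * (koop (T c) (hTm c) + koop (T c⁻¹) (hTm c⁻¹)))
    rw [IsSelfAdjoint, star_mul, star_add, hU, hU, inv_inv, hAsa.star_eq, add_comm, mul_add, add_mul, hAU, hAU]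

include hAc in
/-- Auxiliary `isCompactOperator_jointFamily` of the spectral-dictionary port (its statement is its type; rôle explained in the module ∕ section docstrings). -/
theorem isCompactOperator_jointFamily (j : Option (Γ × Bool)) : IsCompactOperator (jointFamily hTm A j) := by
  rcases j with _ | ⟨c, _ | _⟩
  · exact hAc
  · show IsCompactOperator (Complex.I • (A * (koop (T c) (hTm c) - koop (T c⁻¹) (hTm c⁻¹))))
    have h : IsCompactOperator (A * (koop (T c) (hTm c) - koop (T c⁻¹) (hTm c⁻¹))) := by
      rw [ContinuousLinearMap.mul_def]; exact hAc.comp_clm _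
    have h' := h.smul Complex.I
    rwa [← FunLike.coe_smul] at h'
  · show IsCompactOperator (A * (koop (T c) (hTm c) + koop (T c⁻¹) (hTm c⁻¹)))
    rw [ContinuousLinearMap.mul_def]; exact hAc.comp_clm _

include hTmul hcomm hAU in
/-- Auxiliary `commute_jointFamily` of the spectral-dictionary port (its statement is its type; rôle explained in the module ∕ section docstrings). -/
theorem commute_jointFamily (i j : Option (Γ × Bool)) : Commute (jointFamily hTm A i) (jointFamily hTm A j) := by
  -- base commutations
  have hUU : ∀ c d, Commute (koop (T c) (hTm c)) (koop (T d) (hTm d)) := fun c d => koop_comm hTm hTmul hcomm c d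
  have hAUc : ∀ c, Commute A (koop (T c) (hTm c)) := fun c => hAU c
  set V : Γ → (Lp ℂ 2 μ →L[ℂ] Lp ℂ 2 μ) := fun c => koop (T c) (hTm c) + koop (T c⁻¹) (hTm c⁻¹) with hV
  set W : Γ → (Lp ℂ 2 μ →L[ℂ] Lp ℂ 2 μ) := fun c => koop (T c) (hTm c) - koop (T c⁻¹) (hTm c⁻¹) with hW
  have hAV : ∀ c, Commute A (V c) := fun c => (hAUc c).add_right (hAUc c⁻¹)
  have hAW : ∀ c, Commute A (W c) := fun c => (hAUc c).sub_right (hAUc c⁻¹)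
  have hVV : ∀ c d, Commute (V c) (V d) := fun c d =>
    ((hUU c d).add_right (hUU c d⁻¹)).add_left ((hUU c⁻¹ d).add_right (hUU c⁻¹ d⁻¹))
  have hVW : ∀ c d, Commute (V c) (W d) := fun c d =>
    ((hUU c d).sub_right (hUU c d⁻¹)).add_left ((hUU c⁻¹ d).sub_right (hUU c⁻¹ d⁻¹))
  have hWW : ∀ c d, Commute (W c) (W d) := fun c d =>
    ((hUU c d).sub_right (hUU c d⁻¹)).sub_left ((hUU c⁻¹ d).sub_right (hUU c⁻¹ d⁻¹))
  have hF1 : ∀ c, jointFamily hTm A (some (c, true)) = A * V c := fun c => rfl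
  have hF2 : ∀ c, jointFamily hTm A (some (c, false)) = Complex.I • (A * W c) := fun c => rfl
  have hF0 : jointFamily hTm A none = A := rfl
  -- products
  have hP : ∀ {Y Z : Lp ℂ 2 μ →L[ℂ] Lp ℂ 2 μ}, Commute A Y → Commute A Z → Commute Y Z →
      Commute (A * Y) (A * Z) := fun hY hZ hYZ =>
    Commute.mul_right (Commute.mul_left (Commute.refl A) hY.symm) (Commute.mul_left hZ hYZ)
  have hP0 : ∀ {Y : Lp ℂ 2 μ →L[ℂ] Lp ℂ 2 μ}, Commute A Y → Commute A (A * Y) := fun hY =>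
    Commute.mul_right (Commute.refl A) hY
  rcases i with _ | ⟨c, _ | _⟩ <;> rcases j with _ | ⟨d, _ | _⟩
  · exact Commute.refl A
  · rw [hF0, hF2]; exact (hP0 (hAW d)).smul_right _
  · rw [hF0, hF1]; exact hP0 (hAV d)
  · rw [hF2, hF0]; exact ((hP0 (hAW c)).smul_right _).symm
  · rw [hF2, hF2]; exact ((hP (hAW c) (hAW d) (hWW c d)).smul_right _).smul_left _
  · rw [hF2, hF1]; exact (hP (hAW c) (hAV d) (hVW d c).symm).smul_left _
  · rw [hF1, hF0]; exact (hP0 (hAV c)).symm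
  · rw [hF1, hF2]; exact (hP (hAV c) (hAW d) (hVW c d)).smul_right _
  · rw [hF1, hF1]; exact hP (hAV c) (hAV d) (hVV c d)

include hT1 hTmul hcomm hAsa hAc hAU in
/-- **Joint eigenbasis.**  A Hilbert basis of eigenvectors of `A` (real eigenvalues in `[0, ‖A‖]` under positivity)
on which each twist `U_c` acts, wherever `λᵢ ≠ 0`, by the scalar `χᵢ(c) = ⟪bᵢ, U_c bᵢ⟫`, a unit multiplicative character. -/
theorem exists_jointEigenbasis (hpos : ∀ φ : Lp ℂ 2 μ, 0 ≤ (⟪φ, A φ⟫_ℂ).re) :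
    ∃ (s : Set (Lp ℂ 2 μ)) (b : HilbertBasis s ℂ (Lp ℂ 2 μ)) (lam : s → ℝ) (χ : s → Γ → ℂ),
      (∀ i, (b i : Lp ℂ 2 μ) = i) ∧ (∀ i, A (b i) = (lam i : ℂ) • b i) ∧ (∀ i, 0 ≤ lam i ∧ lam i ≤ ‖A‖) ∧
      (∀ i a a', χ i (a * a') = χ i a * χ i a') ∧ (∀ i a, ‖χ i a‖ = 1) ∧
      (∀ i c, lam i ≠ 0 → koop (T c) (hTm c) (b i) = χ i c • b i) ∧
      (∀ i c, lam i ≠ 0 → χ i c = ⟪(b i : Lp ℂ 2 μ), koop (T c) (hTm c) (b i)⟫_ℂ) := by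
  classical
  set F := jointFamily hTm A with hFdef
  obtain ⟨s, hon, hsp, hjoint⟩ := JointSpectral.exists_orthonormal_dense_jointEigenvectors F
    (isSelfAdjoint_jointFamily hTm hT1 hTmul hAsa hAU) (isCompactOperator_jointFamily hTm hAc)
    (commute_jointFamily hTm hTmul hcomm hAU)
  have hsp' : ⊤ ≤ (Submodule.span ℂ (Set.range ((↑) : s → Lp ℂ 2 μ))).topologicalClosure := by
    rwa [Subtype.range_coe]
  set b : HilbertBasis s ℂ (Lp ℂ 2 μ) := HilbertBasis.mk hon hsp' with hbdef
  have hb : ∀ i : s, (b i : Lp ℂ 2 μ) = i := fun i => by rw [hbdef, HilbertBasis.coe_mk]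
  -- joint eigenvalue patterns
  have hev : ∀ i : s, ∃ α : Option (Γ × Bool) → ℂ, ∀ j, F j i = α j • (i : Lp ℂ 2 μ) := fun i => by
    obtain ⟨α, hα⟩ := hjoint i i.2
    exact ⟨α, (JointSpectral.mem_jointEigenspace_iff F).mp hα⟩
  choose α hα using hev
  have hnorm1 : ∀ i : s, ‖(i : Lp ℂ 2 μ)‖ = 1 := fun i => hon.1 i
  have hinner1 : ∀ i : s, ⟪(i : Lp ℂ 2 μ), (i : Lp ℂ 2 μ)⟫_ℂ = 1 := fun i => by
    rw [inner_self_eq_norm_sq_to_K, hnorm1]; simp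
  -- the `A`-eigenvalue is `⟪i, A i⟫`, real and non-negative
  have hAi : ∀ i : s, A i = α i none • (i : Lp ℂ 2 μ) := fun i => hα i none
  have hαre : ∀ i : s, α i none = ((⟪(i : Lp ℂ 2 μ), A i⟫_ℂ).re : ℂ) := fun i => by
    have h1 : ⟪(i : Lp ℂ 2 μ), A i⟫_ℂ = α i none := by rw [hAi, inner_smul_right, hinner1, mul_one]
    have h2 : ((⟪(i : Lp ℂ 2 μ), A i⟫_ℂ).re : ℂ) = ⟪(i : Lp ℂ 2 μ), A i⟫_ℂ := by
      apply Complex.conj_eq_iff_re.mp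
      rw [inner_conj_symm]
      simpa using hAsa.isSymmetric (i : Lp ℂ 2 μ) (i : Lp ℂ 2 μ)
    rw [← h1, h2]
  set lam : s → ℝ := fun i => (⟪(i : Lp ℂ 2 μ), A i⟫_ℂ).re with hlamdef
  have hlam : ∀ i, A (b i) = (lam i : ℂ) • b i := fun i => by rw [hb, hAi, hαre]
  have hlam0 : ∀ i, 0 ≤ lam i := fun i => hpos _
  have hlamle : ∀ i, lam i ≤ ‖A‖ := fun i => by
    have h := norm_eigval_le_opNorm (b := b) (fun i => hlam i) i
    rw [Complex.norm_real, Real.norm_eq_abs] at h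
    exact (le_abs_self _).trans h
  -- where `λᵢ ≠ 0`, `U_c bᵢ = ⟪bᵢ, U_c bᵢ⟫ bᵢ`
  have hUeig : ∀ i : s, ∀ c, lam i ≠ 0 →
      koop (T c) (hTm c) (i : Lp ℂ 2 μ) = ⟪(i : Lp ℂ 2 μ), koop (T c) (hTm c) i⟫_ℂ • (i : Lp ℂ 2 μ) := by
    intro i c hli
    set Uc := koop (T c) (hTm c) with hUc
    set Ui := koop (T c⁻¹) (hTm c⁻¹) with hUi
    have e1 : A (Uc i) + A (Ui i) = α i (some (c, true)) • (i : Lp ℂ 2 μ) := by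
      have h := hα i (some (c, true))
      simp only [hFdef, jointFamily, mul_apply_eq_comp, add_apply, map_add] at h
      exact h
    have e2 : Complex.I • (A (Uc i) - A (Ui i)) = α i (some (c, false)) • (i : Lp ℂ 2 μ) := by
      have h := hα i (some (c, false))
      simp only [hFdef, jointFamily, smul_apply, mul_apply_eq_comp, sub_apply, map_sub] at h
      exact h
    -- solve for `A (U_c i)`
    have e3' : (2 : ℂ) • A (Uc i) =
        (α i (some (c, true)) - Complex.I * α i (some (c, false))) • (i : Lp ℂ 2 μ) := by
      have hII : -Complex.I * Complex.I = 1 := by rw [neg_mul, Complex.I_mul_I, neg_neg]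
      calc (2 : ℂ) • A (Uc i)
          = (A (Uc i) + A (Ui i)) + (-Complex.I) • (Complex.I • (A (Uc i) - A (Ui i))) := by
            rw [smul_smul, hII, one_smul, two_smul]; abel
        _ = α i (some (c, true)) • (i : Lp ℂ 2 μ) + (-Complex.I) • (α i (some (c, false)) • (i : Lp ℂ 2 μ)) := by
            rw [e1, e2]
        _ = (α i (some (c, true)) - Complex.I * α i (some (c, false))) • (i : Lp ℂ 2 μ) := by
            rw [smul_smul, ← add_smul]; congr 1; ring
    have e3 : A (Uc i) = ((α i (some (c, true)) - Complex.I * α i (some (c, false))) / 2) • (i : Lp ℂ 2 μ) := by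
      have h := congrArg (fun v : Lp ℂ 2 μ => (2 : ℂ)⁻¹ • v) e3'
      simp only [smul_smul, inv_mul_cancel₀ (two_ne_zero' ℂ), one_smul] at h
      rw [h, div_eq_inv_mul]
    -- and `A (U_c i) = U_c (A i) = λᵢ U_c i`
    have e4 : A (Uc i) = (lam i : ℂ) • Uc i := by
      have h := congrArg (fun f : Lp ℂ 2 μ →L[ℂ] Lp ℂ 2 μ => f i) (hAU c)
      simp only [mul_apply_eq_comp] at h
      rw [h, ← hb i, hlam i, map_smul]
    have e5 : Uc i = ((lam i : ℂ)⁻¹ * ((α i (some (c, true)) - Complex.I * α i (some (c, false))) / 2)) •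
        (i : Lp ℂ 2 μ) := by
      rw [← smul_smul, ← e3, e4, smul_smul, inv_mul_cancel₀ (Complex.ofReal_ne_zero.mpr hli), one_smul]
    have e6 : ⟪(i : Lp ℂ 2 μ), Uc i⟫_ℂ =
        (lam i : ℂ)⁻¹ * ((α i (some (c, true)) - Complex.I * α i (some (c, false))) / 2) := by
      rw [e5, inner_smul_right, hinner1, mul_one]
    rw [e6]; exact e5
  set χ : s → Γ → ℂ := fun i c => if lam i = 0 then 1 else ⟪(i : Lp ℂ 2 μ), koop (T c) (hTm c) i⟫_ℂ with hχdef
  have hχ_of_ne : ∀ i c, lam i ≠ 0 → χ i c = ⟪(i : Lp ℂ 2 μ), koop (T c) (hTm c) i⟫_ℂ := fun i c h => by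
    simp only [hχdef, if_neg h]
  have hUχ : ∀ i c, lam i ≠ 0 → koop (T c) (hTm c) (b i) = χ i c • b i := fun i c h => by
    rw [hχ_of_ne i c h, hb]; exact hUeig i c h
  have hχmul : ∀ i a a', χ i (a * a') = χ i a * χ i a' := by
    intro i a a'
    by_cases h : lam i = 0
    · simp only [hχdef, if_pos h, mul_one]
    · rw [hχ_of_ne i _ h, ← hb i, ← koop_mul_koop hTm hTmul a' a, mul_apply_eq_comp, hUχ i a h,
        map_smul, hUχ i a' h, smul_smul, inner_smul_right, hb i, hinner1, mul_one]
  have hχnorm : ∀ i a, ‖χ i a‖ = 1 := by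
    intro i a
    by_cases h : lam i = 0
    · simp only [hχdef, if_pos h, norm_one]
    · have h1 : ‖koop (T a) (hTm a) (b i)‖ = 1 := by rw [norm_koop_apply, hb, hnorm1]
      rw [hUχ i a h, norm_smul, hb, hnorm1, mul_one] at h1
      exact h1
  refine ⟨s, b, lam, χ, hb, hlam, fun i => ⟨hlam0 i, hlamle i⟩, hχmul, hχnorm, hUχ, fun i c h => ?_⟩
  rw [hχ_of_ne i c h, hb]

end Joint

end Summit.QuantumFields.YangMills.Cruxes.IRcof.EquipartitionSeam.SpectralDict

end
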